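import Literature.AlgebraicGeometry.ComplexMultiplication.CyclotomicFermatCMTypesTheoremTwoFactorCount
import HarnessLib

/-!
# Koblitz–Rohrlich p. 1184 «complex multiplication by an order of the FIXED FIELD of `W_{r,s}` and CM-type `H_{r,s}/W_{r,s}`»,
# made explicit: `K₁ = {x ∈ ℚ(ζ_N) | γx = x for every γ with ζ^γ = ζ^w, w ∈ W}`; for the two families at a level prime to `6`,
# `K₁` is the fixed field of the single automorphism `σ_w : ζ_N ↦ ζ_N^w`

Layer `Literature/AlgebraicGeometry/ComplexMultiplication`; sequel of `CyclotomicFermatCMTypesTheoremTwoFactorCount` (this lane gen 41: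
the residue stabiliser `W_{1,a,−1−a}` as an explicit set `{1, w, w²}` ∕ `{1, w}` ∕ `{1, −1−a}` ∕ `{1}` at every `N` prime to `6`, and the
decompositions `A ∼ B³`, `A ∼ B²` into powers of a SIMPLE variety `B` with complex multiplication by the field `K₁` of the primitive
sub-pair `(K₁, Φ₁)` of `Φ_{H_τ}`, `[ℚ(ζ_N) : K₁] = |W|`) and of `CyclotomicCMTypeIsogenyClasses` §4 (gen 14: Shimura's stabiliser
`H' = {γ | γS = S}` read on residues, `mem_stabilizer_iff_forall_unitResidues`; `K₁ = L^{H'}`, `eq_fixedField_stabilizer_of_primitive`).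
There the field `K₁` — Koblitz–Rohrlich's «fixed field of `W_{r,s}`» — is only characterised abstractly (an intermediate field with
`[ℚ(ζ_N) : K₁] = |W|` carrying a primitive type inducing `Φ`).  THIS FILE makes the sentence of p. 1184 explicit.  THEOREMS ONLY (no
definition, no named fact, no `sorry`).

THE SOURCE.  N. Koblitz, D. Rohrlich, *Simple factors in the Jacobian of a Fermat curve*, Canad. J. Math. **30** (1978) 1183–1205,
§1 p. 1184 (held `paper:koblitz1978-simple-factors-jacobian-fermat-curve`, read first-hand): "Let `W_{r,s} = {w ∈ (ℤ/Mℤ)* : wH_{r,s} =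
H_{r,s}}`.  Then `W_{r,s}` is a subgroup of `(ℤ/Mℤ)*` … Suppose `W_{r,s} ≠ {1}`.  Then `L_{r,s}` is isogenous to a product of `|W_{r,s}|`
isomorphic simple factors … These factors have complex multiplication by an order of the fixed field of `W_{r,s}` and CM-type equal to
`H_{r,s}/W_{r,s}` (viewed as a subset of the Galois group of the fixed field of `W_{r,s}` over `ℚ`)."  Here `(ℤ/Mℤ)*` is identified with
`Gal(ℚ(ζ_M)/ℚ)` by `w ↦ (σ_w : ζ_M ↦ ζ_M^w)` (Washington Thm. 2.5; the tree's exponent `a(γ)`, `autResidue`, `γ(ζ_N) = ζ_N^{a(γ)}`), so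
«the fixed field of `W`» is the subfield of `ℚ(ζ_M)` fixed by `{σ_w | w ∈ W}`; and THEOREM 2 (pp. 1185–1186): for `N` prime to `6` the
non-trivial stabilisers are `W = {1, w, w²}` (`1 + w + w² = 0`) and `W = {1, w}` (`w² = 1`, `w ≠ ±1`) — cyclic, generated by one `w`.
G. Shimura, *Abelian varieties with complex multiplication and modular functions* (1998), §8.2 Prop. 26 and its proof («let `K'` be the
subfield of `L` corresponding to `H'`»), §8.4 Example (1) («let `a` be an integer such that `ζ^γ = ζ^a`»).  M. Bauer, A. Coste,
C. Itzykson, P. Ruelle, J. Geom. Phys. **22** (1997), §3.3 (held `paper:arxiv-hep-th_9604104` p. 14): «For `n = 7` … one checks that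
`W_{1,2,4} = H_{1,2,4} = {1,2,4}`, and that the subfield of `ℚ(ζ₇)` fixed by `σ_2` and `σ_4`, is `K = ℚ(√−7)`, with
`𝓞_K = ℤ((1+√−7)/2)`» (§5).

READING.  As in the siblings: level `M = N` (primitive triples normalised through a unit entry to `(1, a, −1−a)`); `W` is the residue
stabiliser `{t ∈ (ℤ/N)ˣ | ∀ c ∈ (ℤ/N)ˣ, ct ∈ S ⟺ c ∈ S}` of the residue set `S = S_Φ` (the `Finset.filter` expression of
`CyclotomicCMTypeIsogenyClasses`, no new definition); "the fixed field of `W`" is typed as a MEMBERSHIP CRITERION for the field `K₁` of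
ANY primitive sub-pair `(K₁, Φ₁)` inducing `Φ` (the pair is unique up to the identifications of Streng Lemma I.3.5; the criterion shows
in particular that `K₁ ⊂ ℚ(ζ_N)` does not depend on the choice); "CM-type `H/W`" is typed as: an embedding `φ` of `ℚ(ζ_N)` restricts
into `Φ₁` iff its exponent `e(φ)` lies in `H` (`Φ₁` is `H` read modulo `W` through restriction).

## What is proved

* §1 (any CM type `Φ` of `L = ℚ(ζ_N)`, any `N`; `(K₁, Φ₁)` any primitive sub-pair with `Φ₁^L = Φ`; `W = W(S_Φ)`):
  `autResidue_one`, `autResidue_pow`; **`mem_stabilizer_iff_autResidue_mem`** (Shimura's `H' = {γ | a(γ) ∈ W}`);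
  **`mem_iff_forall_autResidue_mem_of_primitive`** — «THE FIXED FIELD OF `W`»: `x ∈ K₁ ⟺ γx = x` for every `γ ∈ Gal(ℚ(ζ_N)/ℚ)` with
  `a(γ) ∈ W`; **`forall_apply_eq_iff_autResidue_mem_of_primitive`** — «`W` viewed as a subset of the Galois group»: `γ` fixes `K₁`
  pointwise iff `a(γ) ∈ W` (`Gal(ℚ(ζ_N)/K₁) ≅ W`); **`comp_algebraMap_mem_iff_of_induced`** — «CM-type `H/W`»: `φ|_{K₁} ∈ Φ₁ ⟺ e(φ) ∈
  S_Φ`; `eq_top_of_primitive_of_forall_eq_one` (`W = {1}` ⟹ `K₁ = ℚ(ζ_N)`); `zetaOf_not_mem_of_primitive` (`W ∋ t ≠ 1` ⟹ `ζ_N ∉ K₁`);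
  **`mem_iff_apply_eq_of_primitive_of_forall_exists_pow`** — when `W` consists of powers of `a(σ)` (`W` cyclic generated by `w = a(σ)`),
  `K₁` is the fixed field of the SINGLE automorphism `σ`: `x ∈ K₁ ⟺ σx = x`; `sum_pow_apply_mem_of_primitive` (the trace
  `x + σx + ⋯ + σ^{n−1}x` lies in `K₁` when `σ^n = 1`).
* §2 (namespace `…CyclotomicFermatCMType`; `N` prime to `6`, the K–R types `Φ_{H_{1,a,−1−a}}`; `σ` with `a(σ) = w`):
  FIRST FAMILY `1 + w + w² = 0`, `w ≠ 1` (`W = {1, w, w²}`): `exists_autResidue_eq_firstFamily` (`σ_w` exists), `pow_three_eq_one_of_firstFamily`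
  (`σ_w³ = 1 ≠ σ_w`), **`mem_iff_apply_eq_of_firstFamily`** (`x ∈ K₁ ⟺ σ_w x = x`), **`forall_apply_eq_iff_of_firstFamily`** (`γ` fixes `K₁`
  iff `γ ∈ {1, σ_w, σ_w²}`), `zetaOf_not_mem_of_firstFamily` (`ζ_N ∉ K₁`), `finrank_eq_three_of_firstFamily` (`[ℚ(ζ_N) : K₁] = 3` for ANY
  primitive sub-pair), `zetaOf_add_mem_of_firstFamily` (the Gauss-type period `ζ + ζ^w + ζ^{w²}`, as `ζ + σζ + σ²ζ`, lies in `K₁`),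
  `comp_algebraMap_mem_iff_of_fermat_one` («CM-type `H/W`»: `φ|_{K₁} ∈ Φ₁ ⟺ e(φ) ∈ H_{1,a,−1−a}`, any `a`);
  SECOND FAMILY `w² = 1`, `w ≠ ±1` (`W = {1, w}`): `exists_autResidue_eq_secondFamily`, `pow_two_eq_one_of_secondFamily`,
  **`mem_iff_apply_eq_of_secondFamily`**, **`forall_apply_eq_iff_of_secondFamily`** (`γ ∈ {1, σ_w}`), `zetaOf_not_mem_of_secondFamily`,
  `finrank_eq_two_of_secondFamily`, `zetaOf_add_mem_of_secondFamily` (`ζ + ζ^w ∈ K₁`); the second family through the non-unit position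
  (`(1+a)² = 1`, `a ∉ {0, −2}`, involution `−1−a`): **`mem_iff_apply_eq_of_secondFamily'`**; the generic case (none of the families):
  **`eq_top_of_fermat_one_generic`** (`K₁ = ℚ(ζ_N)`: `A` is simple with CM by the full cyclotomic field).
* §3 THE SENTENCE OF P. 1184 IN FULL, on abelian varieties: **`exists_isIsogeny_cube_simple_fixedField_of_firstFamily`** — for `σ` with
  `ζ^σ = ζ^w`, `1 + w + w² = 0`, `w ≠ 1`, every abelian variety `A` of type `Φ_{H_{1,w,w²}}` is `𝓞_{K₁}`-equivariantly isogenous to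
  `B × B × B` where `K₁ = {x | σx = x}` IS THE FIXED FIELD OF `σ_w` (`ζ_N ∉ K₁`, `[ℚ(ζ_N) : K₁] = 3`), `B` is SIMPLE with complex
  multiplication `𝓞_{K₁} → End B` of the primitive type `Φ₁` = «`H/W`» (`φ|_{K₁} ∈ Φ₁ ⟺ e(φ) ∈ H`), `6 dim B = φ(N)`;
  **`exists_isIsogeny_square_simple_fixedField_of_secondFamily`** — the same for `w² = 1`, `w ≠ ±1`: `A ∼ B × B`, `K₁ = {x | σ_w x = x}` of
  index `2`, `4 dim B = φ(N)`.
* §4 Instances: **`exists_isIsogeny_cube_elliptic_fixedField_seven`** (`N = 7`, `w = 2`, the type `H_{1,2,4}`: `A ∼ E × E × E` with `E` an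
  ELLIPTIC CURVE with complex multiplication by `𝓞_{K₁}`, `K₁ = ℚ(ζ₇)^{σ_2}` quadratic, `ζ₇ ∉ K₁ ∋ ζ₇ + ζ₇² + ζ₇⁴`),
  `exists_autResidue_eq_two_and_realisation_seven` (non-vacuity), **`exists_isIsogeny_square_simple_fixedField_thirtyFive`** (`N = 35`,
  `w = 6`: `A ∼ B × B`, `B` a simple sixfold with CM by `𝓞_{K₁}`, `K₁ = ℚ(ζ₃₅)^{σ_6}` of degree `12`, `ζ₃₅ + ζ₃₅⁶ ∈ K₁`).
* §5 (v2) `N = 7`: **`exists_sq_eq_neg_seven_and_eq_adjoin_seven`** — BCIR §3.3 «the subfield of `ℚ(ζ₇)` fixed by `σ_2` and `σ_4`, is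
  `K = ℚ(√−7)`, with `𝓞_K = ℤ((1+√−7)/2)`»: for any primitive sub-pair of `Φ_{H_{1,2,4}}`, `K₁ ∋ δ = 1 + 2(ζ₇ + ζ₇² + ζ₇⁴)` with
  `δ² = −7`, `K₁ = ℚ(δ)`, `[K₁ : ℚ] = 2`, `(1 + δ)/2` an algebraic integer; with `period_eq_seven` (`ζ + σ_2ζ + σ_2²ζ = ζ + ζ² + ζ⁴`),
  `period_sq_add_period_add_two_seven` (`η² + η + 2 = 0` for the Gauss period `η`), `sq_eq_neg_seven`, `isIntegral_one_add_sqrt_div_two_seven`.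

## Honest column

(a) "An order of the fixed field": the tree's realisations carry the MAXIMAL order `𝓞_{K₁} → End B` (as in gen 14); K–R's lattices
`L_{r,s,t}` may have CM by a smaller order — the isogeny statement is insensitive to this.  (b) `K₁` is identified with a named field
only at `N = 7` (`ℚ(√−7)`, §5; the ring of integers `ℤ((1+√−7)/2)` is not computed — only `(1+δ)/2 ∈ 𝓞`); in general (e.g.
`ℚ(ζ_{N₊})·ℚ(ζ_{N₋})⁺`-type descriptions for the involutions `w`) only the fixed-field criterion, the degree, `ζ_N ∉ K₁` and the periods
`x + σx (+ σ²x) ∈ K₁` are typed.  (c) Levels not prime to `6` (K–R Theorems 3–4)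
have further stabilisers; §1 applies verbatim but is not spelled out there.  The Hodge conjecture is not proved and nothing here bears
on it.
-/

noncomputable section

open NumberField

namespace Literature.AlgebraicGeometry.ComplexMultiplication

open CategoryTheory CategoryTheory.Limits
open Literature.AlgebraicGeometry.Motives (CMType AbelianVariety)
open Literature.AlgebraicGeometry.Motives.AbelianVariety
open Literature.NumberTheory.ComplexMultiplication
open Literature.AlgebraicGeometry.HodgeTheory
open Literature.AlgebraicGeometry.Pohlmann1968 Literature.AlgebraicGeometry.Pohlmann1968.Cyclotomic
open CyclotomicCMTypeResidueSets (IsCMResidueSet unitResidues residueSet residueSet_cmTypeOfResidues autResidue autResidue_spec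
  autResidue_mul autResidue_mem_unitResidues exists_autResidue_eq expOf_mem_residueSet_iff)

/-! ## §1 Any CM type of `ℚ(ζ_N)`: the field of the primitive sub-pair is the fixed field of `{γ | a(γ) ∈ W}` -/

section General

open scoped Pointwise

variable {N : ℕ} [NeZero N] {L : Type} [Field L] [NumberField L] [IsCyclotomicExtension {N} ℚ L]

/-- `a(1) = 1`. [cite: Washington1997, Thm. 2.5] -/
theorem autResidue_one : autResidue N L 1 = 1 := by
  simp [autResidue, map_one]

/-- `a(γ^k) = a(γ)^k`. [cite: Washington1997, Thm. 2.5] -/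
theorem autResidue_pow (γ : L ≃ₐ[ℚ] L) (k : ℕ) : autResidue N L (γ ^ k) = autResidue N L γ ^ k := by
  induction k with
  | zero => rw [pow_zero, pow_zero, autResidue_one]
  | succ k ih => rw [pow_succ, autResidue_mul, ih, pow_succ]

/-- `γ = 1` iff `a(γ) = 1`. [cite: Washington1997, Thm. 2.5] -/
theorem autResidue_eq_one_iff (γ : L ≃ₐ[ℚ] L) : autResidue N L γ = 1 ↔ γ = 1 := by
  rw [← autResidue_one (N := N) (L := L)]
  exact ⟨fun h => autResidue_injective h, fun h => by rw [h]⟩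

/-- A fixed point of `σ` is a fixed point of every power of `σ`. [folklore] -/
private theorem pow_apply_eq_of_apply_eq {σ : L ≃ₐ[ℚ] L} {x : L} (h : σ x = x) (k : ℕ) : (σ ^ k) x = x := by
  induction k with
  | zero => rw [pow_zero, AlgEquiv.one_apply]
  | succ k ih => rw [pow_succ, AlgEquiv.mul_apply, h, ih]

/-- **Shimura's stabiliser `H' = {γ | γS = S}` is `{γ | a(γ) ∈ W}`**, `W` the residue stabiliser of `S_Φ` (the tree's
`mem_stabilizer_iff_forall_unitResidues`, membership form). [cite: Shimura1998, §8.2 Prop. 26] [cite: KoblitzRohrlich1978, §1 p. 1184] -/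
theorem mem_stabilizer_iff_autResidue_mem (Φ : CMType L) (ι : L →+* ℂ) (γ : L ≃ₐ[ℚ] L) :
    γ ∈ MulAction.stabilizer (L ≃ₐ[ℚ] L) (reflexLift (algValuedIn ι Φ.1) (AlgHom.id ℚ L) : Set (L ≃ₐ[ℚ] L)) ↔
      autResidue N L γ ∈ (unitResidues N).filter fun t =>
        ∀ c ∈ unitResidues N, (c * t ∈ residueSet N Φ ↔ c ∈ residueSet N Φ) := by
  rw [mem_stabilizer_iff_forall_unitResidues (N := N), Finset.mem_filter, and_iff_right (autResidue_mem_unitResidues N γ)]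

/-- **KOBLITZ–ROHRLICH'S «FIXED FIELD OF `W_{r,s}`», for every CM type of `ℚ(ζ_N)`.**  If `(K₁, Φ₁)` is a primitive sub-pair inducing `Φ`
(`Φ₁^L = Φ`, `Φ₁` primitive — the field of complex multiplication of the simple factors, `exists_isIsogeny_power_simple_cyclotomic`), then
`x ∈ K₁` iff `γ x = x` for every automorphism `γ` of `ℚ(ζ_N)` whose exponent `a(γ)` (`ζ^γ = ζ^{a(γ)}`) lies in the residue stabiliser `W`:
`K₁` is the fixed field of `{σ_w | w ∈ W}`. [cite: KoblitzRohrlich1978, §1 p. 1184] [cite: Shimura1998, §8.2 proof of Prop. 26]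
[cite: Streng2010, Ch. I Lemma 3.5 (3.6)] -/
theorem mem_iff_forall_autResidue_mem_of_primitive (Φ : CMType L) {K₁ : IntermediateField ℚ L} (Φ₁ : CMType K₁)
    (h₁ : inducedCMType (algebraMap K₁ L) Φ₁ = Φ)
    (hp₁ : ∀ s t : K₁ →+* ℂ,
      (∀ τ : ℂ ≃+* ℂ, (τ : ℂ →+* ℂ).comp s ∈ Φ₁.1 ↔ (τ : ℂ →+* ℂ).comp t ∈ Φ₁.1) → s = t) (x : L) :
    x ∈ K₁ ↔ ∀ γ : L ≃ₐ[ℚ] L, autResidue N L γ ∈ ((unitResidues N).filter fun t =>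
        ∀ c ∈ unitResidues N, (c * t ∈ residueSet N Φ ↔ c ∈ residueSet N Φ)) → γ x = x := by
  haveI : IsGalois ℚ L := IsCyclotomicExtension.isGalois {N} ℚ L
  obtain ⟨ι⟩ : Nonempty (L →+* ℂ) := inferInstance
  have h36 := eq_fixedField_stabilizer_of_primitive Φ ι Φ₁ h₁ hp₁
  rw [h36, IntermediateField.mem_fixedField_iff]
  exact forall_congr' fun γ => by rw [mem_stabilizer_iff_autResidue_mem (N := N) Φ ι γ]

/-- **«`W_{r,s}` viewed as a subset of the Galois group of ℚ(ζ_N)»: `Gal(ℚ(ζ_N)/K₁) = {γ | a(γ) ∈ W}`.**  An automorphism `γ` fixes the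
field `K₁` of the primitive sub-pair pointwise iff its exponent lies in the residue stabiliser (Galois correspondence
`Gal(L/L^{H'}) = H'`). [cite: KoblitzRohrlich1978, §1 p. 1184] [cite: Shimura1998, §8.2 Prop. 26] -/
theorem forall_apply_eq_iff_autResidue_mem_of_primitive (Φ : CMType L) {K₁ : IntermediateField ℚ L} (Φ₁ : CMType K₁)
    (h₁ : inducedCMType (algebraMap K₁ L) Φ₁ = Φ)
    (hp₁ : ∀ s t : K₁ →+* ℂ,
      (∀ τ : ℂ ≃+* ℂ, (τ : ℂ →+* ℂ).comp s ∈ Φ₁.1 ↔ (τ : ℂ →+* ℂ).comp t ∈ Φ₁.1) → s = t) (γ : L ≃ₐ[ℚ] L) :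
    (∀ x ∈ K₁, γ x = x) ↔ autResidue N L γ ∈ (unitResidues N).filter fun t =>
        ∀ c ∈ unitResidues N, (c * t ∈ residueSet N Φ ↔ c ∈ residueSet N Φ) := by
  haveI : IsGalois ℚ L := IsCyclotomicExtension.isGalois {N} ℚ L
  obtain ⟨ι⟩ : Nonempty (L →+* ℂ) := inferInstance
  have h36 := eq_fixedField_stabilizer_of_primitive Φ ι Φ₁ h₁ hp₁
  rw [← mem_stabilizer_iff_autResidue_mem (N := N) Φ ι γ, ← IntermediateField.mem_fixingSubgroup_iff, h36,
    IntermediateField.fixingSubgroup_fixedField]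

/-- **«CM-type equal to `H_{r,s}/W_{r,s}`»**: the primitive type `Φ₁` of `K₁` is the residue set read through restriction — an embedding
`φ` of `ℚ(ζ_N)` restricts to a member of `Φ₁` iff its exponent `e(φ)` lies in `S_Φ`. [cite: KoblitzRohrlich1978, §1 p. 1184]
[cite: Streng2010, Ch. I Def. 3.2] -/
theorem comp_algebraMap_mem_iff_of_induced (Φ : CMType L) {K₁ : IntermediateField ℚ L} (Φ₁ : CMType K₁)
    (h₁ : inducedCMType (algebraMap K₁ L) Φ₁ = Φ) (φ : L →+* ℂ) :
    φ.comp (algebraMap K₁ L) ∈ Φ₁.1 ↔ expOf N L φ ∈ residueSet N Φ := by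
  rw [← mem_inducedCMType_iff, h₁, expOf_mem_residueSet_iff]

/-- **`W = {1}` ⟹ `K₁ = ℚ(ζ_N)`** (the simple case: `A` itself is simple with complex multiplication by the whole cyclotomic field).
[cite: KoblitzRohrlich1978, §1 p. 1184] [cite: Shimura1998, §8.2 Prop. 26] -/
theorem eq_top_of_primitive_of_forall_eq_one (Φ : CMType L) {K₁ : IntermediateField ℚ L} (Φ₁ : CMType K₁)
    (h₁ : inducedCMType (algebraMap K₁ L) Φ₁ = Φ)
    (hp₁ : ∀ s t : K₁ →+* ℂ,
      (∀ τ : ℂ ≃+* ℂ, (τ : ℂ →+* ℂ).comp s ∈ Φ₁.1 ↔ (τ : ℂ →+* ℂ).comp t ∈ Φ₁.1) → s = t)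
    (hW : ∀ t ∈ ((unitResidues N).filter fun t =>
        ∀ c ∈ unitResidues N, (c * t ∈ residueSet N Φ ↔ c ∈ residueSet N Φ)), t = 1) :
    K₁ = ⊤ := by
  rw [eq_top_iff]
  intro x _
  rw [mem_iff_forall_autResidue_mem_of_primitive (N := N) Φ Φ₁ h₁ hp₁]
  intro γ hγ
  rw [(autResidue_eq_one_iff (N := N) γ).1 (hW _ hγ), AlgEquiv.one_apply]

/-- **`W ≠ {1}` ⟹ `ζ_N ∉ K₁`**: if the stabiliser contains some `t ≠ 1`, the automorphism `σ_t` (`ζ ↦ ζ^t`) fixes `K₁` but moves `ζ_N`, so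
`K₁` is a proper subfield not containing `ζ_N`. [cite: KoblitzRohrlich1978, §1 p. 1184] [cite: Washington1997, Thm. 2.5] -/
theorem zetaOf_not_mem_of_primitive (Φ : CMType L) {K₁ : IntermediateField ℚ L} (Φ₁ : CMType K₁)
    (h₁ : inducedCMType (algebraMap K₁ L) Φ₁ = Φ)
    (hp₁ : ∀ s t : K₁ →+* ℂ,
      (∀ τ : ℂ ≃+* ℂ, (τ : ℂ →+* ℂ).comp s ∈ Φ₁.1 ↔ (τ : ℂ →+* ℂ).comp t ∈ Φ₁.1) → s = t) {t : ZMod N}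
    (ht : t ∈ ((unitResidues N).filter fun t =>
        ∀ c ∈ unitResidues N, (c * t ∈ residueSet N Φ ↔ c ∈ residueSet N Φ))) (ht1 : t ≠ 1) :
    zetaOf N L ∉ K₁ := by
  intro hζ
  obtain ⟨γ, hγ⟩ := exists_autResidue_eq N (L := L) t (Finset.mem_filter.1 ht).1
  have hfix := (mem_iff_forall_autResidue_mem_of_primitive (N := N) Φ Φ₁ h₁ hp₁ _).1 hζ γ (hγ ▸ ht)
  rw [autResidue_spec N γ, hγ] at hfix
  have hprim : IsPrimitiveRoot (zetaOf N L) N := IsCyclotomicExtension.zeta_spec N ℚ L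
  have h1N : 1 < N := by
    rcases Nat.lt_or_ge 1 N with h | h
    · exact h
    · exfalso
      have hN1 : N = 1 := le_antisymm h (Nat.pos_of_ne_zero (NeZero.ne N))
      subst hN1
      exact ht1 (Subsingleton.elim t 1)
  have hval : t.val = 1 := by
    have := hprim.pow_inj (ZMod.val_lt t) h1N (by rw [pow_one]; exact hfix)
    exact this
  apply ht1
  have h1 : (1 : ZMod N).val = 1 := by
    rw [ZMod.val_one_eq_one_mod, Nat.mod_eq_of_lt h1N]
  exact ZMod.val_injective N (hval.trans h1.symm)

/-- **`W` cyclic, generated by `w = a(σ)` ⟹ `K₁` is the fixed field of the single automorphism `σ`.**  If every element of the residue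
stabiliser is a power of `a(σ)` and `a(σ) ∈ W`, then `x ∈ K₁ ⟺ σ x = x` (the case of both families of K–R Theorem 2: `W = {1, w, w²}`,
`W = {1, w}`). [cite: KoblitzRohrlich1978, §1 p. 1184 and Theorem 2] [cite: Shimura1998, §8.2 Prop. 26] -/
theorem mem_iff_apply_eq_of_primitive_of_forall_exists_pow (Φ : CMType L) {K₁ : IntermediateField ℚ L} (Φ₁ : CMType K₁)
    (h₁ : inducedCMType (algebraMap K₁ L) Φ₁ = Φ)
    (hp₁ : ∀ s t : K₁ →+* ℂ,
      (∀ τ : ℂ ≃+* ℂ, (τ : ℂ →+* ℂ).comp s ∈ Φ₁.1 ↔ (τ : ℂ →+* ℂ).comp t ∈ Φ₁.1) → s = t) {σ : L ≃ₐ[ℚ] L}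
    (hσ : autResidue N L σ ∈ ((unitResidues N).filter fun t =>
        ∀ c ∈ unitResidues N, (c * t ∈ residueSet N Φ ↔ c ∈ residueSet N Φ)))
    (hW : ∀ t ∈ ((unitResidues N).filter fun t =>
        ∀ c ∈ unitResidues N, (c * t ∈ residueSet N Φ ↔ c ∈ residueSet N Φ)), ∃ k : ℕ, t = autResidue N L σ ^ k) (x : L) :
    x ∈ K₁ ↔ σ x = x := by
  rw [mem_iff_forall_autResidue_mem_of_primitive (N := N) Φ Φ₁ h₁ hp₁]
  refine ⟨fun h => h σ hσ, fun h γ hγ => ?_⟩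
  obtain ⟨k, hk⟩ := hW _ hγ
  rw [← autResidue_pow] at hk
  rw [autResidue_injective hk]
  exact pow_apply_eq_of_apply_eq h k

/-- **The periods `x + σx + ⋯ + σ^{n−1}x` lie in `K₁`** when `σ^n = 1` and `K₁` is the fixed field of `σ` (e.g. `ζ + ζ^w + ζ^{w²}` for the
first family, `ζ + ζ^w` for the second). [cite: KoblitzRohrlich1978, §1 p. 1184] [cite: Washington1997, Thm. 2.5] -/
theorem sum_pow_apply_mem_of_primitive {K₁ : IntermediateField ℚ L} {σ : L ≃ₐ[ℚ] L} (hK : ∀ x : L, x ∈ K₁ ↔ σ x = x) {n : ℕ}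
    (hn : σ ^ n = 1) (x : L) : (∑ k ∈ Finset.range n, (σ ^ k) x) ∈ K₁ := by
  rw [hK, map_sum]
  have hshift : ∀ k, σ ((σ ^ k) x) = (σ ^ (k + 1)) x := fun k => by
    rw [pow_succ', AlgEquiv.mul_apply]
  simp_rw [hshift]
  cases n with
  | zero => rw [Finset.sum_range_zero, Finset.sum_range_zero]
  | succ m => rw [Finset.sum_range_succ, Finset.sum_range_succ', hn, pow_zero]

end General

/-! ## §2 The Koblitz–Rohrlich types at a level prime to `6`: `K₁` is the fixed field of `σ_w` -/

namespace CyclotomicFermatCMType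

section Families

variable {N : ℕ} [NeZero N] {L : Type} [Field L] [NumberField L] [IsCyclotomicExtension {N} ℚ L]
  {a : ZMod N}
  {hS : ∀ c : ZMod N, c.val.Coprime N → (c ∈ fermatCMType N 1 a (-1 - a) ↔ -c ∉ fermatCMType N 1 a (-1 - a))}

/-- **«CM-type `H_{r,s}/W_{r,s}`» for the K–R types**: for any sub-pair `(K₁, Φ₁)` inducing `Φ_{H_{1,a,−1−a}}`, an embedding `φ` of `ℚ(ζ_N)`
restricts into `Φ₁` iff `e(φ) ∈ H_{1,a,−1−a}`. [cite: KoblitzRohrlich1978, §1 p. 1184] -/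
theorem comp_algebraMap_mem_iff_of_fermat_one {K₁ : IntermediateField ℚ L} (Φ₁ : CMType K₁)
    (h₁ : inducedCMType (algebraMap K₁ L) Φ₁ = cmTypeOfResidues (L := L) (fermatCMType N 1 a (-1 - a)) hS) (φ : L →+* ℂ) :
    φ.comp (algebraMap K₁ L) ∈ Φ₁.1 ↔ expOf N L φ ∈ fermatCMType N 1 a (-1 - a) := by
  rw [comp_algebraMap_mem_iff_of_induced (N := N) _ Φ₁ h₁, residueSet_cmTypeOfResidues_fermat_one]

/-! ### First family `1 + w + w² = 0`, `w ≠ 1`: `W = {1, w, w²}`, `K₁ = L^{σ_w}` of index `3` -/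

/-- `w` is a unit (`w · w² = 1`), so `σ_w` exists: an automorphism of `ℚ(ζ_N)` with `ζ^σ = ζ^w`. [cite: Washington1997, Thm. 2.5] -/
theorem exists_autResidue_eq_firstFamily (hf : 1 + a + a ^ 2 = 0) : ∃ σ : L ≃ₐ[ℚ] L, autResidue N L σ = a := by
  refine exists_autResidue_eq N a ((mem_unitResidues_iff_isUnit a).2 (IsUnit.of_mul_eq_one (a ^ 2) ?_))
  linear_combination (a - 1) * hf

/-- `σ_w³ = 1` and `σ_w ≠ 1` for the first family. [cite: KoblitzRohrlich1978, Theorem 2] [cite: Washington1997, Thm. 2.5] -/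
theorem pow_three_eq_one_of_firstFamily (hf : 1 + a + a ^ 2 = 0) (ha1 : a ≠ 1) {σ : L ≃ₐ[ℚ] L} (hσ : autResidue N L σ = a) :
    σ ^ 3 = 1 ∧ σ ≠ 1 := by
  refine ⟨(autResidue_eq_one_iff (N := N) _).1 ?_, fun h => ha1 ?_⟩
  · rw [autResidue_pow, hσ]
    linear_combination (a - 1) * hf
  · rw [← hσ, h, autResidue_one]

/-- **FIRST FAMILY: `K₁` IS THE FIXED FIELD OF `σ_w`.**  For `N` prime to `6`, `1 + w + w² = 0`, `w ≠ 1`, any primitive sub-pair `(K₁, Φ₁)`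
inducing `Φ_{H_{1,w,w²}}` and any `σ` with `ζ^σ = ζ^w`: `x ∈ K₁ ⟺ σ x = x`. [cite: KoblitzRohrlich1978, §1 p. 1184 and Theorem 2]
[cite: Shimura1998, §8.2 Prop. 26] -/
theorem mem_iff_apply_eq_of_firstFamily (hN2 : Nat.Coprime 2 N) (hN3 : Nat.Coprime 3 N) (hf : 1 + a + a ^ 2 = 0) (ha1 : a ≠ 1)
    {K₁ : IntermediateField ℚ L} (Φ₁ : CMType K₁)
    (h₁ : inducedCMType (algebraMap K₁ L) Φ₁ = cmTypeOfResidues (L := L) (fermatCMType N 1 a (-1 - a)) hS)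
    (hp₁ : ∀ s t : K₁ →+* ℂ,
      (∀ τ : ℂ ≃+* ℂ, (τ : ℂ →+* ℂ).comp s ∈ Φ₁.1 ↔ (τ : ℂ →+* ℂ).comp t ∈ Φ₁.1) → s = t)
    {σ : L ≃ₐ[ℚ] L} (hσ : autResidue N L σ = a) (x : L) : x ∈ K₁ ↔ σ x = x := by
  refine mem_iff_apply_eq_of_primitive_of_forall_exists_pow (N := N) _ Φ₁ h₁ hp₁ ?_ ?_ x
  · rw [residueSet_cmTypeOfResidues_fermat_one, stabilizerResidues_fermat_one_eq_triple_coprimeSix hN2 hN3 hf ha1, hσ]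
    simp
  · intro t ht
    rw [residueSet_cmTypeOfResidues_fermat_one, stabilizerResidues_fermat_one_eq_triple_coprimeSix hN2 hN3 hf ha1,
      Finset.mem_insert, Finset.mem_insert, Finset.mem_singleton] at ht
    rcases ht with h | h | h
    · exact ⟨0, by rw [h, pow_zero]⟩
    · exact ⟨1, by rw [h, hσ, pow_one]⟩
    · exact ⟨2, by rw [h, hσ]⟩

/-- **First family, «`W` viewed as a subset of the Galois group»**: `γ` fixes `K₁` pointwise iff `γ ∈ {1, σ_w, σ_w²}`
(`Gal(ℚ(ζ_N)/K₁) = ⟨σ_w⟩` of order `3`). [cite: KoblitzRohrlich1978, §1 p. 1184 and Theorem 2] [cite: Shimura1998, §8.2 Prop. 26] -/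
theorem forall_apply_eq_iff_of_firstFamily (hN2 : Nat.Coprime 2 N) (hN3 : Nat.Coprime 3 N) (hf : 1 + a + a ^ 2 = 0) (ha1 : a ≠ 1)
    {K₁ : IntermediateField ℚ L} (Φ₁ : CMType K₁)
    (h₁ : inducedCMType (algebraMap K₁ L) Φ₁ = cmTypeOfResidues (L := L) (fermatCMType N 1 a (-1 - a)) hS)
    (hp₁ : ∀ s t : K₁ →+* ℂ,
      (∀ τ : ℂ ≃+* ℂ, (τ : ℂ →+* ℂ).comp s ∈ Φ₁.1 ↔ (τ : ℂ →+* ℂ).comp t ∈ Φ₁.1) → s = t)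
    {σ : L ≃ₐ[ℚ] L} (hσ : autResidue N L σ = a) (γ : L ≃ₐ[ℚ] L) :
    (∀ x ∈ K₁, γ x = x) ↔ γ = 1 ∨ γ = σ ∨ γ = σ ^ 2 := by
  rw [forall_apply_eq_iff_autResidue_mem_of_primitive (N := N) _ Φ₁ h₁ hp₁, residueSet_cmTypeOfResidues_fermat_one,
    stabilizerResidues_fermat_one_eq_triple_coprimeSix hN2 hN3 hf ha1, Finset.mem_insert, Finset.mem_insert, Finset.mem_singleton,
    autResidue_eq_one_iff, ← hσ, ← autResidue_pow, autResidue_injective.eq_iff, autResidue_injective.eq_iff]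

/-- First family: `ζ_N ∉ K₁` (`σ_w` moves `ζ_N`). [cite: KoblitzRohrlich1978, §1 p. 1184] [cite: Washington1997, Thm. 2.5] -/
theorem zetaOf_not_mem_of_firstFamily (hN2 : Nat.Coprime 2 N) (hN3 : Nat.Coprime 3 N) (hf : 1 + a + a ^ 2 = 0) (ha1 : a ≠ 1)
    {K₁ : IntermediateField ℚ L} (Φ₁ : CMType K₁)
    (h₁ : inducedCMType (algebraMap K₁ L) Φ₁ = cmTypeOfResidues (L := L) (fermatCMType N 1 a (-1 - a)) hS)
    (hp₁ : ∀ s t : K₁ →+* ℂ,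
      (∀ τ : ℂ ≃+* ℂ, (τ : ℂ →+* ℂ).comp s ∈ Φ₁.1 ↔ (τ : ℂ →+* ℂ).comp t ∈ Φ₁.1) → s = t) :
    zetaOf N L ∉ K₁ := by
  refine zetaOf_not_mem_of_primitive (N := N) _ Φ₁ h₁ hp₁ (t := a) ?_ ha1
  rw [residueSet_cmTypeOfResidues_fermat_one, stabilizerResidues_fermat_one_eq_triple_coprimeSix hN2 hN3 hf ha1]
  simp

/-- First family: `[ℚ(ζ_N) : K₁] = 3` for ANY primitive sub-pair. [cite: KoblitzRohrlich1978, §1 p. 1184 and Theorem 2] -/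
theorem finrank_eq_three_of_firstFamily (hN2 : Nat.Coprime 2 N) (hN3 : Nat.Coprime 3 N) (hf : 1 + a + a ^ 2 = 0) (ha1 : a ≠ 1)
    {K₁ : IntermediateField ℚ L} (Φ₁ : CMType K₁)
    (h₁ : inducedCMType (algebraMap K₁ L) Φ₁ = cmTypeOfResidues (L := L) (fermatCMType N 1 a (-1 - a)) hS)
    (hp₁ : ∀ s t : K₁ →+* ℂ,
      (∀ τ : ℂ ≃+* ℂ, (τ : ℂ →+* ℂ).comp s ∈ Φ₁.1 ↔ (τ : ℂ →+* ℂ).comp t ∈ Φ₁.1) → s = t) :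
    Module.finrank K₁ L = 3 := by
  rw [finrank_eq_card_filter_of_primitive (N := N) _ Φ₁ h₁ hp₁]
  exact card_stabilizerResidues_cmTypeOfResidues_fermat_one_eq_three hN2 hN3 hf ha1

/-- First family: the period `ζ + σζ + σ²ζ = ζ + ζ^w + ζ^{w²}` lies in `K₁`. [cite: KoblitzRohrlich1978, §1 p. 1184]
[cite: Washington1997, Thm. 2.5] -/
theorem zetaOf_add_mem_of_firstFamily (hN2 : Nat.Coprime 2 N) (hN3 : Nat.Coprime 3 N) (hf : 1 + a + a ^ 2 = 0) (ha1 : a ≠ 1)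
    {K₁ : IntermediateField ℚ L} (Φ₁ : CMType K₁)
    (h₁ : inducedCMType (algebraMap K₁ L) Φ₁ = cmTypeOfResidues (L := L) (fermatCMType N 1 a (-1 - a)) hS)
    (hp₁ : ∀ s t : K₁ →+* ℂ,
      (∀ τ : ℂ ≃+* ℂ, (τ : ℂ →+* ℂ).comp s ∈ Φ₁.1 ↔ (τ : ℂ →+* ℂ).comp t ∈ Φ₁.1) → s = t)
    {σ : L ≃ₐ[ℚ] L} (hσ : autResidue N L σ = a) :
    zetaOf N L + σ (zetaOf N L) + (σ ^ 2) (zetaOf N L) ∈ K₁ := by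
  have h := sum_pow_apply_mem_of_primitive (mem_iff_apply_eq_of_firstFamily hN2 hN3 hf ha1 Φ₁ h₁ hp₁ hσ)
    (pow_three_eq_one_of_firstFamily (N := N) hf ha1 hσ).1 (zetaOf N L)
  simpa [Finset.sum_range_succ, add_assoc] using h

/-! ### Second family `w² = 1`, `w ≠ ±1`: `W = {1, w}`, `K₁ = L^{σ_w}` of index `2` -/

/-- `w` is a unit (`w² = 1`), so `σ_w` exists. [cite: Washington1997, Thm. 2.5] -/
theorem exists_autResidue_eq_secondFamily (hsq : a ^ 2 = 1) : ∃ σ : L ≃ₐ[ℚ] L, autResidue N L σ = a :=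
  exists_autResidue_eq N a ((mem_unitResidues_iff_isUnit a).2 (IsUnit.of_mul_eq_one a (by rw [← sq, hsq])))

/-- `σ_w² = 1` and `σ_w ≠ 1` for the second family. [cite: KoblitzRohrlich1978, Theorem 2] [cite: Washington1997, Thm. 2.5] -/
theorem pow_two_eq_one_of_secondFamily (hsq : a ^ 2 = 1) (ha1 : a ≠ 1) {σ : L ≃ₐ[ℚ] L} (hσ : autResidue N L σ = a) :
    σ ^ 2 = 1 ∧ σ ≠ 1 := by
  refine ⟨(autResidue_eq_one_iff (N := N) _).1 ?_, fun h => ha1 ?_⟩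
  · rw [autResidue_pow, hσ, hsq]
  · rw [← hσ, h, autResidue_one]

/-- **SECOND FAMILY: `K₁` IS THE FIXED FIELD OF `σ_w`.**  For `N` prime to `6`, `w² = 1`, `w ≠ ±1`, any primitive sub-pair `(K₁, Φ₁)`
inducing `Φ_{H_{1,w,−1−w}}` and any `σ` with `ζ^σ = ζ^w`: `x ∈ K₁ ⟺ σ x = x`. [cite: KoblitzRohrlich1978, §1 p. 1184 and Theorem 2]
[cite: Shimura1998, §8.2 Prop. 26] -/
theorem mem_iff_apply_eq_of_secondFamily (hN2 : Nat.Coprime 2 N) (hN3 : Nat.Coprime 3 N) (hsq : a ^ 2 = 1) (ha1 : a ≠ 1)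
    (ha1' : a ≠ -1) {K₁ : IntermediateField ℚ L} (Φ₁ : CMType K₁)
    (h₁ : inducedCMType (algebraMap K₁ L) Φ₁ = cmTypeOfResidues (L := L) (fermatCMType N 1 a (-1 - a)) hS)
    (hp₁ : ∀ s t : K₁ →+* ℂ,
      (∀ τ : ℂ ≃+* ℂ, (τ : ℂ →+* ℂ).comp s ∈ Φ₁.1 ↔ (τ : ℂ →+* ℂ).comp t ∈ Φ₁.1) → s = t)
    {σ : L ≃ₐ[ℚ] L} (hσ : autResidue N L σ = a) (x : L) : x ∈ K₁ ↔ σ x = x := by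
  refine mem_iff_apply_eq_of_primitive_of_forall_exists_pow (N := N) _ Φ₁ h₁ hp₁ ?_ ?_ x
  · rw [residueSet_cmTypeOfResidues_fermat_one, stabilizerResidues_fermat_one_eq_pair_coprimeSix hN2 hN3 hsq ha1 ha1', hσ]
    simp
  · intro t ht
    rw [residueSet_cmTypeOfResidues_fermat_one, stabilizerResidues_fermat_one_eq_pair_coprimeSix hN2 hN3 hsq ha1 ha1',
      Finset.mem_insert, Finset.mem_singleton] at ht
    rcases ht with h | h
    · exact ⟨0, by rw [h, pow_zero]⟩
    · exact ⟨1, by rw [h, hσ, pow_one]⟩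

/-- **Second family, «`W` viewed as a subset of the Galois group»**: `γ` fixes `K₁` pointwise iff `γ ∈ {1, σ_w}`.
[cite: KoblitzRohrlich1978, §1 p. 1184 and Theorem 2] [cite: Shimura1998, §8.2 Prop. 26] -/
theorem forall_apply_eq_iff_of_secondFamily (hN2 : Nat.Coprime 2 N) (hN3 : Nat.Coprime 3 N) (hsq : a ^ 2 = 1) (ha1 : a ≠ 1)
    (ha1' : a ≠ -1) {K₁ : IntermediateField ℚ L} (Φ₁ : CMType K₁)
    (h₁ : inducedCMType (algebraMap K₁ L) Φ₁ = cmTypeOfResidues (L := L) (fermatCMType N 1 a (-1 - a)) hS)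
    (hp₁ : ∀ s t : K₁ →+* ℂ,
      (∀ τ : ℂ ≃+* ℂ, (τ : ℂ →+* ℂ).comp s ∈ Φ₁.1 ↔ (τ : ℂ →+* ℂ).comp t ∈ Φ₁.1) → s = t)
    {σ : L ≃ₐ[ℚ] L} (hσ : autResidue N L σ = a) (γ : L ≃ₐ[ℚ] L) :
    (∀ x ∈ K₁, γ x = x) ↔ γ = 1 ∨ γ = σ := by
  rw [forall_apply_eq_iff_autResidue_mem_of_primitive (N := N) _ Φ₁ h₁ hp₁, residueSet_cmTypeOfResidues_fermat_one,
    stabilizerResidues_fermat_one_eq_pair_coprimeSix hN2 hN3 hsq ha1 ha1', Finset.mem_insert, Finset.mem_singleton,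
    autResidue_eq_one_iff, ← hσ, autResidue_injective.eq_iff]

/-- Second family: `ζ_N ∉ K₁`. [cite: KoblitzRohrlich1978, §1 p. 1184] [cite: Washington1997, Thm. 2.5] -/
theorem zetaOf_not_mem_of_secondFamily (hN2 : Nat.Coprime 2 N) (hN3 : Nat.Coprime 3 N) (hsq : a ^ 2 = 1) (ha1 : a ≠ 1)
    (ha1' : a ≠ -1) {K₁ : IntermediateField ℚ L} (Φ₁ : CMType K₁)
    (h₁ : inducedCMType (algebraMap K₁ L) Φ₁ = cmTypeOfResidues (L := L) (fermatCMType N 1 a (-1 - a)) hS)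
    (hp₁ : ∀ s t : K₁ →+* ℂ,
      (∀ τ : ℂ ≃+* ℂ, (τ : ℂ →+* ℂ).comp s ∈ Φ₁.1 ↔ (τ : ℂ →+* ℂ).comp t ∈ Φ₁.1) → s = t) :
    zetaOf N L ∉ K₁ := by
  refine zetaOf_not_mem_of_primitive (N := N) _ Φ₁ h₁ hp₁ (t := a) ?_ ha1
  rw [residueSet_cmTypeOfResidues_fermat_one, stabilizerResidues_fermat_one_eq_pair_coprimeSix hN2 hN3 hsq ha1 ha1']
  simp

/-- Second family: `[ℚ(ζ_N) : K₁] = 2` for ANY primitive sub-pair. [cite: KoblitzRohrlich1978, §1 p. 1184 and Theorem 2] -/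
theorem finrank_eq_two_of_secondFamily (hN2 : Nat.Coprime 2 N) (hN3 : Nat.Coprime 3 N) (hsq : a ^ 2 = 1) (ha1 : a ≠ 1)
    (ha1' : a ≠ -1) {K₁ : IntermediateField ℚ L} (Φ₁ : CMType K₁)
    (h₁ : inducedCMType (algebraMap K₁ L) Φ₁ = cmTypeOfResidues (L := L) (fermatCMType N 1 a (-1 - a)) hS)
    (hp₁ : ∀ s t : K₁ →+* ℂ,
      (∀ τ : ℂ ≃+* ℂ, (τ : ℂ →+* ℂ).comp s ∈ Φ₁.1 ↔ (τ : ℂ →+* ℂ).comp t ∈ Φ₁.1) → s = t) :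
    Module.finrank K₁ L = 2 := by
  rw [finrank_eq_card_filter_of_primitive (N := N) _ Φ₁ h₁ hp₁]
  exact card_stabilizerResidues_cmTypeOfResidues_fermat_one_eq_two hN2 hN3 hsq ha1 ha1'

/-- Second family: the period `ζ + σζ = ζ + ζ^w` lies in `K₁`. [cite: KoblitzRohrlich1978, §1 p. 1184] [cite: Washington1997, Thm. 2.5] -/
theorem zetaOf_add_mem_of_secondFamily (hN2 : Nat.Coprime 2 N) (hN3 : Nat.Coprime 3 N) (hsq : a ^ 2 = 1) (ha1 : a ≠ 1)
    (ha1' : a ≠ -1) {K₁ : IntermediateField ℚ L} (Φ₁ : CMType K₁)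
    (h₁ : inducedCMType (algebraMap K₁ L) Φ₁ = cmTypeOfResidues (L := L) (fermatCMType N 1 a (-1 - a)) hS)
    (hp₁ : ∀ s t : K₁ →+* ℂ,
      (∀ τ : ℂ ≃+* ℂ, (τ : ℂ →+* ℂ).comp s ∈ Φ₁.1 ↔ (τ : ℂ →+* ℂ).comp t ∈ Φ₁.1) → s = t)
    {σ : L ≃ₐ[ℚ] L} (hσ : autResidue N L σ = a) :
    zetaOf N L + σ (zetaOf N L) ∈ K₁ := by
  have h := sum_pow_apply_mem_of_primitive (mem_iff_apply_eq_of_secondFamily hN2 hN3 hsq ha1 ha1' Φ₁ h₁ hp₁ hσ)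
    (pow_two_eq_one_of_secondFamily (N := N) hsq ha1 hσ).1 (zetaOf N L)
  simpa [Finset.sum_range_succ] using h

/-- **The second family through the non-unit position** (`(1 + a)² = 1`, `a ∉ {0, −2}`; `W = {1, −1−a}`, the involution is `w = −1−a`):
`K₁` is the fixed field of `σ_{−1−a}`. [cite: KoblitzRohrlich1978, §1 p. 1184 and Theorem 2] [cite: Shimura1998, §8.2 Prop. 26] -/
theorem mem_iff_apply_eq_of_secondFamily' (hN2 : Nat.Coprime 2 N) (hN3 : Nat.Coprime 3 N) (hsq : (1 + a) ^ 2 = 1) (ha : a ≠ 0)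
    (ha2 : a ≠ -2) {K₁ : IntermediateField ℚ L} (Φ₁ : CMType K₁)
    (h₁ : inducedCMType (algebraMap K₁ L) Φ₁ = cmTypeOfResidues (L := L) (fermatCMType N 1 a (-1 - a)) hS)
    (hp₁ : ∀ s t : K₁ →+* ℂ,
      (∀ τ : ℂ ≃+* ℂ, (τ : ℂ →+* ℂ).comp s ∈ Φ₁.1 ↔ (τ : ℂ →+* ℂ).comp t ∈ Φ₁.1) → s = t)
    {σ : L ≃ₐ[ℚ] L} (hσ : autResidue N L σ = -1 - a) (x : L) : x ∈ K₁ ↔ σ x = x := by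
  refine mem_iff_apply_eq_of_primitive_of_forall_exists_pow (N := N) _ Φ₁ h₁ hp₁ ?_ ?_ x
  · rw [residueSet_cmTypeOfResidues_fermat_one, stabilizerResidues_fermat_one_eq_pair'_coprimeSix hN2 hN3 hsq ha ha2, hσ]
    simp
  · intro t ht
    rw [residueSet_cmTypeOfResidues_fermat_one, stabilizerResidues_fermat_one_eq_pair'_coprimeSix hN2 hN3 hsq ha ha2,
      Finset.mem_insert, Finset.mem_singleton] at ht
    rcases ht with h | h
    · exact ⟨0, by rw [h, pow_zero]⟩
    · exact ⟨1, by rw [h, hσ, pow_one]⟩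

/-- **The generic case (`A` simple): `K₁ = ℚ(ζ_N)`.**  Outside the two families (`a, −1−a ≠ 0`; neither `1 + a + a² = 0 ∧ a ≠ 1`, nor
`a² = 1 ∧ a ≠ ±1`, nor `(1+a)² = 1 ∧ a ∉ {0,−2}`) the stabiliser is `{1}` and the field of the primitive sub-pair is the whole cyclotomic
field. [cite: KoblitzRohrlich1978, §1 p. 1184 and Theorem 2] [cite: Shimura1998, §8.2 Prop. 26] -/
theorem eq_top_of_fermat_one_generic (hN2 : Nat.Coprime 2 N) (hN3 : Nat.Coprime 3 N) (ha : a ≠ 0) (ha' : (-1 - a : ZMod N) ≠ 0)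
    (hn₁ : ¬(1 + a + a ^ 2 = 0 ∧ a ≠ 1)) (hn₂ : ¬(a ^ 2 = 1 ∧ a ≠ 1 ∧ a ≠ -1)) (hn₃ : ¬((1 + a) ^ 2 = 1 ∧ a ≠ 0 ∧ a ≠ -2))
    {K₁ : IntermediateField ℚ L} (Φ₁ : CMType K₁)
    (h₁ : inducedCMType (algebraMap K₁ L) Φ₁ = cmTypeOfResidues (L := L) (fermatCMType N 1 a (-1 - a)) hS)
    (hp₁ : ∀ s t : K₁ →+* ℂ,
      (∀ τ : ℂ ≃+* ℂ, (τ : ℂ →+* ℂ).comp s ∈ Φ₁.1 ↔ (τ : ℂ →+* ℂ).comp t ∈ Φ₁.1) → s = t) :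
    K₁ = ⊤ := by
  refine eq_top_of_primitive_of_forall_eq_one (N := N) _ Φ₁ h₁ hp₁ fun t ht => ?_
  rw [residueSet_cmTypeOfResidues_fermat_one,
    stabilizerResidues_fermat_one_eq_singleton_coprimeSix hN2 hN3 ha ha' hn₁ hn₂ hn₃, Finset.mem_singleton] at ht
  exact ht

end Families

/-! ## §3 The sentence of p. 1184 in full: `A ∼ B³` ∕ `A ∼ B²` with `B` simple, CM by the fixed field `L^{σ_w}`, of type `H/W` -/

section Varieties

variable {N : ℕ} [NeZero N] {L : Type} [Field L] [NumberField L] [IsCyclotomicExtension {N} ℚ L]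
  {a : ZMod N}
  {hS : ∀ c : ZMod N, c.val.Coprime N → (c ∈ fermatCMType N 1 a (-1 - a) ↔ -c ∉ fermatCMType N 1 a (-1 - a))}
  {A : AbelianVariety ℂ} {ι : 𝓞 L →+* End A} {θ : L →+* Module.End ℂ (complexBetti A.X 1)}

/-- **KOBLITZ–ROHRLICH P. 1184 FOR THE FIRST FAMILY, IN FULL.**  `N` prime to `6`, `1 + w + w² = 0`, `w ≠ 1`, `σ = σ_w` (`ζ^σ = ζ^w`):
every abelian variety `A` of type `(ℚ(ζ_N); Φ_{H_{1,w,w²}})` is `𝓞_{K₁}`-equivariantly isogenous to `B × B × B`, where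
`K₁ = {x ∈ ℚ(ζ_N) | σ x = x}` IS THE FIXED FIELD OF `W = ⟨w⟩` (a CM field with `ζ_N ∉ K₁`, `[ℚ(ζ_N) : K₁] = 3`), `B` is SIMPLE with
complex multiplication `𝓞_{K₁} → End B` and CM type `Φ₁` = «`H/W`» (`φ|_{K₁} ∈ Φ₁ ⟺ e(φ) ∈ H_{1,w,w²}`, `Φ₁` primitive, `Φ₁^L = Φ_H`),
`6 dim B = φ(N)`. [cite: KoblitzRohrlich1978, §1 (p. 1184) and Theorem 2 (pp. 1185–1186)] [cite: Shimura1998, §8.2 Prop. 26, §6.2 Thm. 3]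
[cite: MilneCM2006, Ch. I §3, proof of Prop. 3.13] -/
theorem exists_isIsogeny_cube_simple_fixedField_of_firstFamily (hN2 : Nat.Coprime 2 N) (hN3 : Nat.Coprime 3 N)
    (hf : 1 + a + a ^ 2 = 0) (ha1 : a ≠ 1) {σ : L ≃ₐ[ℚ] L} (hσ : autResidue N L σ = a)
    (hA : IsCMTypeRealisation (cmTypeOfResidues (L := L) (fermatCMType N 1 a (-1 - a)) hS) A ι θ) :
    ∃ (K₁ : IntermediateField ℚ L) (Φ₁ : CMType K₁), IsCMField K₁ ∧
      (∀ x : L, x ∈ K₁ ↔ σ x = x) ∧ zetaOf N L ∉ K₁ ∧ Module.finrank K₁ L = 3 ∧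
      inducedCMType (algebraMap K₁ L) Φ₁ = cmTypeOfResidues (L := L) (fermatCMType N 1 a (-1 - a)) hS ∧
      (∀ φ : L →+* ℂ, φ.comp (algebraMap K₁ L) ∈ Φ₁.1 ↔ expOf N L φ ∈ fermatCMType N 1 a (-1 - a)) ∧
      (∀ s t : K₁ →+* ℂ,
        (∀ τ : ℂ ≃+* ℂ, (τ : ℂ →+* ℂ).comp s ∈ Φ₁.1 ↔ (τ : ℂ →+* ℂ).comp t ∈ Φ₁.1) → s = t) ∧
      ∃ (B : AbelianVariety ℂ) (ιB : 𝓞 K₁ →+* End B) (θB : K₁ →+* Module.End ℂ (complexBetti B.X 1)),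
        IsCMTypeRealisation Φ₁ B ιB θB ∧ B.IsSimple ∧ 6 * B.dim = N.totient ∧
        ∃ (P : AbelianVariety ℂ) (π : Fin 3 → (P ⟶ B)), Nonempty (IsLimit (Fan.mk P π)) ∧
          ∃ g : A ⟶ P, IsIsogeny g ∧
            ∀ j (b : 𝓞 K₁), ι (RingOfIntegers.mapRingHom (algebraMap K₁ L : K₁ →+* L) b) ≫ (g ≫ π j) =
              (g ≫ π j) ≫ ιB b := by
  obtain ⟨K₁, Φ₁, hCM, h₁, hp₁, hW, B, ιB, θB, hB, hs, hdim, P, π, hP, g, hg, hequiv⟩ :=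
    exists_isIsogeny_cube_simple_of_fermat_one_coprimeSix hN2 hN3 hf ha1 hA
  exact ⟨K₁, Φ₁, hCM, mem_iff_apply_eq_of_firstFamily hN2 hN3 hf ha1 Φ₁ h₁ hp₁ hσ,
    zetaOf_not_mem_of_firstFamily hN2 hN3 hf ha1 Φ₁ h₁ hp₁, hW, h₁, comp_algebraMap_mem_iff_of_fermat_one Φ₁ h₁, hp₁,
    B, ιB, θB, hB, hs, hdim, P, π, hP, g, hg, hequiv⟩

/-- **KOBLITZ–ROHRLICH P. 1184 FOR THE SECOND FAMILY, IN FULL.**  `N` prime to `6`, `w² = 1`, `w ≠ ±1`, `σ = σ_w`: every abelian variety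
`A` of type `(ℚ(ζ_N); Φ_{H_{1,w,−1−w}})` is `𝓞_{K₁}`-equivariantly isogenous to `B × B`, where `K₁ = {x | σ x = x}` is the fixed field
of the involution `σ_w` (`ζ_N ∉ K₁`, index `2`), `B` SIMPLE with complex multiplication by `𝓞_{K₁}` of the primitive type `Φ₁` = «`H/W`»,
`4 dim B = φ(N)`. [cite: KoblitzRohrlich1978, §1 (p. 1184) and Theorem 2 (pp. 1185–1186)] [cite: Shimura1998, §8.2 Prop. 26, §6.2 Thm. 3]
[cite: MilneCM2006, Ch. I §3, proof of Prop. 3.13] -/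
theorem exists_isIsogeny_square_simple_fixedField_of_secondFamily (hN2 : Nat.Coprime 2 N) (hN3 : Nat.Coprime 3 N)
    (hsq : a ^ 2 = 1) (ha1 : a ≠ 1) (ha1' : a ≠ -1) {σ : L ≃ₐ[ℚ] L} (hσ : autResidue N L σ = a)
    (hA : IsCMTypeRealisation (cmTypeOfResidues (L := L) (fermatCMType N 1 a (-1 - a)) hS) A ι θ) :
    ∃ (K₁ : IntermediateField ℚ L) (Φ₁ : CMType K₁), IsCMField K₁ ∧
      (∀ x : L, x ∈ K₁ ↔ σ x = x) ∧ zetaOf N L ∉ K₁ ∧ Module.finrank K₁ L = 2 ∧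
      inducedCMType (algebraMap K₁ L) Φ₁ = cmTypeOfResidues (L := L) (fermatCMType N 1 a (-1 - a)) hS ∧
      (∀ φ : L →+* ℂ, φ.comp (algebraMap K₁ L) ∈ Φ₁.1 ↔ expOf N L φ ∈ fermatCMType N 1 a (-1 - a)) ∧
      (∀ s t : K₁ →+* ℂ,
        (∀ τ : ℂ ≃+* ℂ, (τ : ℂ →+* ℂ).comp s ∈ Φ₁.1 ↔ (τ : ℂ →+* ℂ).comp t ∈ Φ₁.1) → s = t) ∧
      ∃ (B : AbelianVariety ℂ) (ιB : 𝓞 K₁ →+* End B) (θB : K₁ →+* Module.End ℂ (complexBetti B.X 1)),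
        IsCMTypeRealisation Φ₁ B ιB θB ∧ B.IsSimple ∧ 4 * B.dim = N.totient ∧
        ∃ (P : AbelianVariety ℂ) (π : Fin 2 → (P ⟶ B)), Nonempty (IsLimit (Fan.mk P π)) ∧
          ∃ g : A ⟶ P, IsIsogeny g ∧
            ∀ j (b : 𝓞 K₁), ι (RingOfIntegers.mapRingHom (algebraMap K₁ L : K₁ →+* L) b) ≫ (g ≫ π j) =
              (g ≫ π j) ≫ ιB b := by
  obtain ⟨K₁, Φ₁, hCM, h₁, hp₁, hW, B, ιB, θB, hB, hs, hdim, P, π, hP, g, hg, hequiv⟩ :=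
    exists_isIsogeny_square_simple_of_fermat_one_coprimeSix hN2 hN3 hsq ha1 ha1' hA
  exact ⟨K₁, Φ₁, hCM, mem_iff_apply_eq_of_secondFamily hN2 hN3 hsq ha1 ha1' Φ₁ h₁ hp₁ hσ,
    zetaOf_not_mem_of_secondFamily hN2 hN3 hsq ha1 ha1' Φ₁ h₁ hp₁, hW, h₁, comp_algebraMap_mem_iff_of_fermat_one Φ₁ h₁, hp₁,
    B, ιB, θB, hB, hs, hdim, P, π, hP, g, hg, hequiv⟩

end Varieties

/-! ## §4 Instances: `N = 7`, `w = 2` (elliptic cube factors with CM by the quadratic field `L^{σ_2}`); `N = 35`, `w = 6` -/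

section Instances

/-- **`N = 7`, `w = 2`** (`1 + 2 + 4 ≡ 0`; the type `H_{1,2,4}`): for `σ = σ_2` (`ζ₇ ↦ ζ₇²`) every abelian variety `A` of type
`Φ_{H_{1,2,4}}` is `𝓞_{K₁}`-equivariantly isogenous to `E × E × E` with `E` an ELLIPTIC CURVE (`dim E = 1`) with complex multiplication
`𝓞_{K₁} → End E`, `K₁ = {x ∈ ℚ(ζ₇) | σ_2 x = x}` the subfield of index `3` (so `[K₁ : ℚ] = 2`), `ζ₇ ∉ K₁`, `ζ₇ + ζ₇² + ζ₇⁴ ∈ K₁`.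
[cite: KoblitzRohrlich1978, §1 (p. 1184) and Theorem 2] [cite: Shimura1998, §8.2 Prop. 26, §6.2 Thm. 3] -/
theorem exists_isIsogeny_cube_elliptic_fixedField_seven {L : Type} [Field L] [NumberField L] [IsCyclotomicExtension {7} ℚ L]
    {hS : ∀ c : ZMod 7, c.val.Coprime 7 → (c ∈ fermatCMType 7 1 2 (-1 - 2) ↔ -c ∉ fermatCMType 7 1 2 (-1 - 2))}
    {A : AbelianVariety ℂ} {ι : 𝓞 L →+* End A} {θ : L →+* Module.End ℂ (complexBetti A.X 1)}
    {σ : L ≃ₐ[ℚ] L} (hσ : autResidue 7 L σ = 2)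
    (hA : IsCMTypeRealisation (cmTypeOfResidues (L := L) (fermatCMType 7 1 2 (-1 - 2)) hS) A ι θ) :
    ∃ (K₁ : IntermediateField ℚ L) (Φ₁ : CMType K₁), IsCMField K₁ ∧
      (∀ x : L, x ∈ K₁ ↔ σ x = x) ∧ zetaOf 7 L ∉ K₁ ∧ zetaOf 7 L + σ (zetaOf 7 L) + (σ ^ 2) (zetaOf 7 L) ∈ K₁ ∧
      Module.finrank K₁ L = 3 ∧ Module.finrank ℚ K₁ = 2 ∧
      inducedCMType (algebraMap K₁ L) Φ₁ = cmTypeOfResidues (L := L) (fermatCMType 7 1 2 (-1 - 2)) hS ∧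
      ∃ (E : AbelianVariety ℂ) (ιE : 𝓞 K₁ →+* End E) (θE : K₁ →+* Module.End ℂ (complexBetti E.X 1)),
        IsCMTypeRealisation Φ₁ E ιE θE ∧ E.dim = 1 ∧
        ∃ (P : AbelianVariety ℂ) (π : Fin 3 → (P ⟶ E)), Nonempty (IsLimit (Fan.mk P π)) ∧
          ∃ g : A ⟶ P, IsIsogeny g ∧
            ∀ j (b : 𝓞 K₁), ι (RingOfIntegers.mapRingHom (algebraMap K₁ L : K₁ →+* L) b) ≫ (g ≫ π j) =
              (g ≫ π j) ≫ ιE b := by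
  have hN2 : Nat.Coprime 2 7 := by decide
  have hN3 : Nat.Coprime 3 7 := by decide
  have hf : (1 : ZMod 7) + 2 + 2 ^ 2 = 0 := by decide
  have ha1 : (2 : ZMod 7) ≠ 1 := by decide
  obtain ⟨K₁, Φ₁, hCM, hK, hζ, hW, h₁, -, hp₁, E, ιE, θE, hE, -, hdim, P, π, hP, g, hg, hequiv⟩ :=
    exists_isIsogeny_cube_simple_fixedField_of_firstFamily hN2 hN3 hf ha1 hσ hA
  have htot : Nat.totient 7 = 6 := by decide
  have hdeg : Module.finrank ℚ K₁ = 2 := by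
    have hmul := Module.finrank_mul_finrank ℚ K₁ L
    rw [hW, finrank_eq_totient 7 L, htot] at hmul
    omega
  exact ⟨K₁, Φ₁, hCM, hK, hζ, zetaOf_add_mem_of_firstFamily hN2 hN3 hf ha1 Φ₁ h₁ hp₁ hσ, hW, hdeg, h₁, E, ιE, θE, hE,
    by omega, P, π, hP, g, hg, hequiv⟩

/-- Non-vacuity at `7`: `σ_2` exists and `Φ_{H_{1,2,4}}` is realised (by threefolds). [cite: Shimura1998, §6.2 Thm. 3]
[cite: Washington1997, Thm. 2.5] -/
theorem exists_autResidue_eq_two_and_realisation_seven {L : Type} [Field L] [NumberField L] [IsCyclotomicExtension {7} ℚ L] :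
    (∃ σ : L ≃ₐ[ℚ] L, autResidue 7 L σ = 2) ∧
      ∃ (hS : ∀ c : ZMod 7, c.val.Coprime 7 → (c ∈ fermatCMType 7 1 2 (-1 - 2) ↔ -c ∉ fermatCMType 7 1 2 (-1 - 2)))
        (A : AbelianVariety ℂ) (ι : 𝓞 L →+* End A) (θ : L →+* Module.End ℂ (complexBetti A.X 1)),
        IsCMTypeRealisation (cmTypeOfResidues (L := L) (fermatCMType 7 1 2 (-1 - 2)) hS) A ι θ ∧ A.dim = 3 := by
  refine ⟨exists_autResidue_eq_firstFamily (by decide), ?_⟩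
  obtain ⟨hS, A, ι, θ, hA, hd⟩ := exists_isCMTypeRealisation_fermat (L := L) (M := 7) (by norm_num)
    (r := 1) (s := 2) (t := -1 - 2) (by decide) (by decide) (by decide) (by decide)
  exact ⟨hS, A, ι, θ, hA, by rw [hd]; decide⟩

/-- **`N = 35`, `w = 6`** (`6² = 36 ≡ 1`, `6 ≢ ±1`; the second family, which needs two primes): for `σ = σ_6` every abelian variety of
type `Φ_{H_{1,6,28}}` is `𝓞_{K₁}`-equivariantly isogenous to `B × B`, `B` a SIMPLE abelian SIXFOLD with complex multiplication by
`𝓞_{K₁}`, `K₁ = {x ∈ ℚ(ζ₃₅) | σ_6 x = x}` of index `2` (`[K₁ : ℚ] = 12`), `ζ₃₅ ∉ K₁`, `ζ₃₅ + ζ₃₅⁶ ∈ K₁`.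
[cite: KoblitzRohrlich1978, §1 (p. 1184) and Theorem 2] [cite: Shimura1998, §8.2 Prop. 26, §6.2 Thm. 3] -/
theorem exists_isIsogeny_square_simple_fixedField_thirtyFive {L : Type} [Field L] [NumberField L]
    [IsCyclotomicExtension {35} ℚ L]
    {hS : ∀ c : ZMod 35, c.val.Coprime 35 → (c ∈ fermatCMType 35 1 6 (-1 - 6) ↔ -c ∉ fermatCMType 35 1 6 (-1 - 6))}
    {A : AbelianVariety ℂ} {ι : 𝓞 L →+* End A} {θ : L →+* Module.End ℂ (complexBetti A.X 1)}
    {σ : L ≃ₐ[ℚ] L} (hσ : autResidue 35 L σ = 6)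
    (hA : IsCMTypeRealisation (cmTypeOfResidues (L := L) (fermatCMType 35 1 6 (-1 - 6)) hS) A ι θ) :
    ∃ (K₁ : IntermediateField ℚ L) (Φ₁ : CMType K₁), IsCMField K₁ ∧
      (∀ x : L, x ∈ K₁ ↔ σ x = x) ∧ zetaOf 35 L ∉ K₁ ∧ zetaOf 35 L + σ (zetaOf 35 L) ∈ K₁ ∧
      Module.finrank K₁ L = 2 ∧ Module.finrank ℚ K₁ = 12 ∧
      inducedCMType (algebraMap K₁ L) Φ₁ = cmTypeOfResidues (L := L) (fermatCMType 35 1 6 (-1 - 6)) hS ∧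
      ∃ (B : AbelianVariety ℂ) (ιB : 𝓞 K₁ →+* End B) (θB : K₁ →+* Module.End ℂ (complexBetti B.X 1)),
        IsCMTypeRealisation Φ₁ B ιB θB ∧ B.IsSimple ∧ B.dim = 6 ∧
        ∃ (P : AbelianVariety ℂ) (π : Fin 2 → (P ⟶ B)), Nonempty (IsLimit (Fan.mk P π)) ∧
          ∃ g : A ⟶ P, IsIsogeny g ∧
            ∀ j (b : 𝓞 K₁), ι (RingOfIntegers.mapRingHom (algebraMap K₁ L : K₁ →+* L) b) ≫ (g ≫ π j) =
              (g ≫ π j) ≫ ιB b := by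
  have hN2 : Nat.Coprime 2 35 := by decide
  have hN3 : Nat.Coprime 3 35 := by decide
  have hsq : (6 : ZMod 35) ^ 2 = 1 := by decide
  have ha1 : (6 : ZMod 35) ≠ 1 := by decide
  have ha1' : (6 : ZMod 35) ≠ -1 := by decide
  obtain ⟨K₁, Φ₁, hCM, hK, hζ, hW, h₁, -, hp₁, B, ιB, θB, hB, hs, hdim, P, π, hP, g, hg, hequiv⟩ :=
    exists_isIsogeny_square_simple_fixedField_of_secondFamily hN2 hN3 hsq ha1 ha1' hσ hA
  have htot : Nat.totient 35 = 24 := by decide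
  have hdeg : Module.finrank ℚ K₁ = 12 := by
    have hmul := Module.finrank_mul_finrank ℚ K₁ L
    rw [hW, finrank_eq_totient 35 L, htot] at hmul
    omega
  exact ⟨K₁, Φ₁, hCM, hK, hζ, zetaOf_add_mem_of_secondFamily hN2 hN3 hsq ha1 ha1' Φ₁ h₁ hp₁ hσ, hW, hdeg, h₁, B, ιB, θB,
    hB, hs, by omega, P, π, hP, g, hg, hequiv⟩

end Instances

/-! ## §5 `N = 7`: the fixed field of `σ_2` is `ℚ(√−7)` — «the subfield of `ℚ(ζ₇)` fixed by `σ_2` and `σ_4`, is `K = ℚ(√−7)`» -/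

section Seven

variable {L : Type} [Field L] [NumberField L] [IsCyclotomicExtension {7} ℚ L]

/-- `ζ₇⁷ = 1`. [folklore] -/
private theorem zetaOf_pow_seven : zetaOf 7 L ^ 7 = 1 :=
  (IsCyclotomicExtension.zeta_spec 7 ℚ L).pow_eq_one

/-- `1 + ζ₇ + ζ₇² + ⋯ + ζ₇⁶ = 0`. [folklore] -/
private theorem geom_sum_zetaOf_seven :
    1 + zetaOf 7 L + zetaOf 7 L ^ 2 + zetaOf 7 L ^ 3 + zetaOf 7 L ^ 4 + zetaOf 7 L ^ 5 + zetaOf 7 L ^ 6 = 0 := by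
  have h := (IsCyclotomicExtension.zeta_spec 7 ℚ L).geom_sum_eq_zero (by norm_num)
  simpa [Finset.sum_range_succ, zetaOf] using h

/-- For `σ = σ_2` (`ζ₇^σ = ζ₇²`): `σζ₇ = ζ₇²` and `σ²ζ₇ = ζ₇⁴`, so the period `ζ₇ + σζ₇ + σ²ζ₇` is the Gauss period `η = ζ₇ + ζ₇² + ζ₇⁴`.
[cite: BauerCosteItzyksonRuelle1997, §3.3 (n = 7)] [cite: Washington1997, Thm. 2.5] -/
theorem period_eq_seven {σ : L ≃ₐ[ℚ] L} (hσ : autResidue 7 L σ = 2) :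
    zetaOf 7 L + σ (zetaOf 7 L) + (σ ^ 2) (zetaOf 7 L) = zetaOf 7 L + zetaOf 7 L ^ 2 + zetaOf 7 L ^ 4 := by
  have h1 : σ (zetaOf 7 L) = zetaOf 7 L ^ 2 := by
    rw [autResidue_spec 7 σ, hσ]
    rfl
  have h2 : (σ ^ 2) (zetaOf 7 L) = zetaOf 7 L ^ 4 := by
    rw [pow_two, AlgEquiv.mul_apply, h1, map_pow, h1, ← pow_mul]
  rw [h1, h2]

/-- **The Gauss period `η = ζ₇ + ζ₇² + ζ₇⁴` satisfies `η² + η + 2 = 0`** (discriminant `−7`). [cite: BauerCosteItzyksonRuelle1997, §3.3 (n = 7)] -/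
theorem period_sq_add_period_add_two_seven :
    (zetaOf 7 L + zetaOf 7 L ^ 2 + zetaOf 7 L ^ 4) ^ 2 + (zetaOf 7 L + zetaOf 7 L ^ 2 + zetaOf 7 L ^ 4) + 2 = 0 := by
  have h7 := zetaOf_pow_seven (L := L)
  have hg := geom_sum_zetaOf_seven (L := L)
  linear_combination 2 * hg + zetaOf 7 L * h7

/-- **`δ = 1 + 2η = 1 + 2(ζ₇ + ζ₇² + ζ₇⁴)` is a square root of `−7` in `ℚ(ζ₇)`.** [cite: BauerCosteItzyksonRuelle1997, §3.3 (n = 7)] -/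
theorem sq_eq_neg_seven :
    (1 + 2 * (zetaOf 7 L + zetaOf 7 L ^ 2 + zetaOf 7 L ^ 4)) ^ 2 = -7 := by
  linear_combination 4 * period_sq_add_period_add_two_seven (L := L)

/-- `(1 + δ)/2 = 1 + η` is an algebraic integer (a sum of roots of unity) — BCIR's `𝓞_K = ℤ((1+√−7)/2) ∋ (1+√−7)/2`.
[cite: BauerCosteItzyksonRuelle1997, §3.3 (n = 7)] -/
theorem isIntegral_one_add_sqrt_div_two_seven :
    IsIntegral ℤ ((1 + (1 + 2 * (zetaOf 7 L + zetaOf 7 L ^ 2 + zetaOf 7 L ^ 4))) / 2) := by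
  have hζ : IsIntegral ℤ (zetaOf 7 L) := (IsCyclotomicExtension.zeta_spec 7 ℚ L).isIntegral (by norm_num)
  have heq : (1 + (1 + 2 * (zetaOf 7 L + zetaOf 7 L ^ 2 + zetaOf 7 L ^ 4))) / 2 =
      1 + (zetaOf 7 L + zetaOf 7 L ^ 2 + zetaOf 7 L ^ 4) := by
    field_simp
    ring
  rw [heq]
  exact isIntegral_one.add ((hζ.add (hζ.pow 2)).add (hζ.pow 4))

/-- **BCIR §3.3 ∕ K–R p. 1184 at `N = 7`: THE FIXED FIELD OF `σ_2` IS `ℚ(√−7)`.**  For any primitive sub-pair `(K₁, Φ₁)` inducing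
`Φ_{H_{1,2,4}}` (the field of complex multiplication of the elliptic curve `E` with `A ∼ E³`, §4): `K₁` contains
`δ = 1 + 2(ζ₇ + ζ₇² + ζ₇⁴)` with `δ² = −7`, `K₁ = ℚ(δ)`, `[K₁ : ℚ] = 2`, and `(1 + δ)/2` is an algebraic integer («the subfield of
`ℚ(ζ₇)` fixed by `σ_2` and `σ_4`, is `K = ℚ(√−7)`, with `𝓞_K = ℤ((1+√−7)/2)`» — the ring of integers itself is not identified here).
[cite: BauerCosteItzyksonRuelle1997, §3.3 (n = 7)] [cite: KoblitzRohrlich1978, §1 (p. 1184) and Theorem 2] -/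
theorem exists_sq_eq_neg_seven_and_eq_adjoin_seven
    {hS : ∀ c : ZMod 7, c.val.Coprime 7 → (c ∈ fermatCMType 7 1 2 (-1 - 2) ↔ -c ∉ fermatCMType 7 1 2 (-1 - 2))}
    {K₁ : IntermediateField ℚ L} (Φ₁ : CMType K₁)
    (h₁ : inducedCMType (algebraMap K₁ L) Φ₁ = cmTypeOfResidues (L := L) (fermatCMType 7 1 2 (-1 - 2)) hS)
    (hp₁ : ∀ s t : K₁ →+* ℂ,
      (∀ τ : ℂ ≃+* ℂ, (τ : ℂ →+* ℂ).comp s ∈ Φ₁.1 ↔ (τ : ℂ →+* ℂ).comp t ∈ Φ₁.1) → s = t) :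
    ∃ δ : L, δ ∈ K₁ ∧ δ ^ 2 = -7 ∧ K₁ = IntermediateField.adjoin ℚ {δ} ∧ Module.finrank ℚ K₁ = 2 ∧
      IsIntegral ℤ ((1 + δ) / 2) := by
  have hN2 : Nat.Coprime 2 7 := by decide
  have hN3 : Nat.Coprime 3 7 := by decide
  have hf : (1 : ZMod 7) + 2 + 2 ^ 2 = 0 := by decide
  have ha1 : (2 : ZMod 7) ≠ 1 := by decide
  obtain ⟨σ, hσ⟩ := exists_autResidue_eq_firstFamily (L := L) hf
  set δ : L := 1 + 2 * (zetaOf 7 L + zetaOf 7 L ^ 2 + zetaOf 7 L ^ 4) with hδ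
  -- `δ ∈ K₁`: the period lies in `K₁`
  have hη : zetaOf 7 L + zetaOf 7 L ^ 2 + zetaOf 7 L ^ 4 ∈ K₁ := by
    rw [← period_eq_seven hσ]
    exact zetaOf_add_mem_of_firstFamily hN2 hN3 hf ha1 Φ₁ h₁ hp₁ hσ
  have hδK : δ ∈ K₁ := add_mem (one_mem K₁) (mul_mem (by exact_mod_cast (natCast_mem K₁ 2)) hη)
  have hsq : δ ^ 2 = -7 := sq_eq_neg_seven (L := L)
  -- `[K₁ : ℚ] = 2`
  have hdeg : Module.finrank ℚ K₁ = 2 := by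
    have hmul := Module.finrank_mul_finrank ℚ K₁ L
    have htot : Nat.totient 7 = 6 := by decide
    rw [finrank_eq_three_of_firstFamily hN2 hN3 hf ha1 Φ₁ h₁ hp₁, finrank_eq_totient 7 L, htot] at hmul
    omega
  -- `ℚ(δ) ≠ ℚ` since `−7` is not a rational square
  have hle : IntermediateField.adjoin ℚ {δ} ≤ K₁ := IntermediateField.adjoin_simple_le_iff.2 hδK
  have hne : Module.finrank ℚ (IntermediateField.adjoin ℚ {δ}) ≠ 1 := by
    intro h1
    rw [IntermediateField.finrank_eq_one_iff, IntermediateField.adjoin_simple_eq_bot_iff, IntermediateField.mem_bot] at h1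
    obtain ⟨q, hq⟩ := h1
    have hq2 : (algebraMap ℚ L) (q ^ 2) = (algebraMap ℚ L) (-7) := by
      rw [map_pow, hq, hsq, map_neg, map_ofNat]
    have hq2' : q ^ 2 = -7 := (algebraMap ℚ L).injective hq2
    nlinarith [sq_nonneg q]
  have hdvd : Module.finrank ℚ (IntermediateField.adjoin ℚ {δ}) ∣ 2 := hdeg ▸ IntermediateField.finrank_dvd_of_le_right hle
  have h2 : Module.finrank ℚ (IntermediateField.adjoin ℚ {δ}) = 2 := by
    rcases (Nat.dvd_prime Nat.prime_two).1 hdvd with h | h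
    · exact absurd h hne
    · exact h
  refine ⟨δ, hδK, hsq, (IntermediateField.eq_of_le_of_finrank_eq hle (h2.trans hdeg.symm)).symm, hdeg, ?_⟩
  rw [hδ]
  exact isIntegral_one_add_sqrt_div_two_seven

end Seven

end CyclotomicFermatCMType

end Literature.AlgebraicGeometry.ComplexMultiplication
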